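import Summits.QuantumAdvantage.QuantumAdvantage.Theorems.CubicForrelationNearExactIsExactSixteenResidual
import Summits.QuantumAdvantage.QuantumAdvantage.Theorems.CubicForrelationNearExactIsExactConcatAveraging
import Summits.QuantumAdvantage.QuantumAdvantage.Theorems.CubicForrelationNearExactIsExactRothausB

/-!
# Crux `CubicForrelation.NearExactIsExact` (stmt-QuantumAdvantage-14043) — Walsh CAPACITY of cubics on 16 bits with a
  non-zero level-6 parity is at most `31/32`

Certificate seat `b2b-cforr-cert` (gen 3; rung `θ₁₆ ≤ 31/32`).  HONEST FRAMING: a theorem about cubic Boolean functions on 16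
bits — a finite-slice verdict toward the `θ_n` ladder, NOT summit progress.

THEOREM `sx_capacity_31_32`.  Let `g : 𝔽₂¹⁶ → 𝔽₂` be cubic with `W_g = 64u` (Ax) and suppose some `u(x)` is odd (the level-6
parity of the landed 2-adic tower does not vanish; the tower alone then only gives `Σ|W_g| ≤ (63/64)·2²⁴`).  Then
`Σ_x |W_g(x)| ≤ (31/32)·2²⁴`.

Proof.  Parseval `Σ u² = 2²⁰` and ONE pointwise inequality (`sx_pt`), valid for every integer `v`:
`8|v| ≤ v² + 16 − [v odd] − 4·[v ≡ 2 (4)] − 16·[v ≡ 0 (8)] − 8·[v ≡ ±1 (8)]`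
(the four brackets in Euclidean digits: `d₀`; `¬d₀ ∧ d₁`; `¬d₀ ∧ ¬d₁ ∧ ¬d₂`; `d₀ ∧ (d₁ ↔ d₂)`).  Summing,
`8·Σ|u| ≤ 2²¹ − #odd − 4#A − 16#B − 8#C`, and `Σ|W_g| ≤ (31/32)·2²⁴ ⟺ 8·Σ|u| ≤ 2²¹ − 2¹⁶`.
* all `u` odd (type O): `#odd = 2¹⁶`;
* otherwise the affine parity is balanced, `#odd = 2¹⁵` (`sx_card_odd_of_split`), and with the digit degrees `1, 2, 4`
  (`…SixteenDigits`) and the Reed–Muller bound (`bb_rmWeight_holds`): `A = supp(¬d₀ ∧ d₁)` has degree `≤ 3`, so `#A ≥ 2¹³`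
  unless empty; if `A = ∅` then `B = supp(¬d₀ ∧ ¬d₂)` has degree `≤ 5`, `#B ≥ 2¹¹` unless empty; if `A = B = ∅` then
  `C = supp ¬(d₁ ⊕ d₂)` has degree `≤ 4`, `#C ≥ 2¹²` unless empty; each alternative supplies the missing `2¹⁵`, and
  `A = B = C = ∅` is the residual configuration excluded by `sx_residual_false` (`…SixteenResidual`).
Numerics of this seat (not used in the proofs, `work/c/`): random and structured (Maiorana–McFarland-type, hill-climbed)
non-bent cubics on 16 bits never exceeded capacity `0.93`.

References: J. Ax (1964) / R. J. McEliece (1972) (Carlet 2021 §4.1); MacWilliams–Sloane Ch. 13–15; R. O'Donnell, *Analysis of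
Boolean Functions* (2014) §1.4 (Parseval).  Everything below is proved from Mathlib and the tree; axioms are the standard three.
-/

set_option linter.dupNamespace false -- D-0017: single-problem summit ⇒ `QuantumAdvantage.QuantumAdvantage` by design

noncomputable section

namespace Summit.QuantumAdvantage.QuantumAdvantage.Theorems.CubicForrelation.NearExactIsExact

open Finset
open Literature.Computability.QuantumComplexity
open Literature.Computability.QuantumComplexity.DerivativeWalsh (W)

/-! ### The pointwise inequality -/

/-- **The pointwise inequality behind `31/32`.** For every integer `v`:
`8|v| ≤ v² + 16 − [v odd] − 4·[¬d₀ ∧ d₁] − 16·[¬d₀ ∧ ¬d₁ ∧ ¬d₂] − 8·[d₀ ∧ (d₁ ↔ d₂)]` in the Euclidean binary digits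
`d₀ = [v odd]`, `d₁ = [⌊v/2⌋ odd]`, `d₂ = [⌊v/4⌋ odd]` (i.e. `v ≡ 2 (mod 4)`, `v ≡ 0 (mod 8)`, `v ≡ ±1 (mod 8)`); equality at
`|v| ∈ {0,…,8} ∖ {…}` per residue (`|v| ≤ 7` is a finite check, `|v| ≥ 8` gives `8|v| ≤ v²`). [this work] -/
theorem sx_pt (v : ℤ) :
    8 * |v| ≤ v ^ 2 + 16 - (if Odd v then 1 else 0) - 4 * (if ¬ Odd v ∧ Odd (v / 2) then 1 else 0)
      - 16 * (if ¬ Odd v ∧ ¬ Odd (v / 2) ∧ ¬ Odd (v / 2 / 2) then 1 else 0)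
      - 8 * (if Odd v ∧ (Odd (v / 2) ↔ Odd (v / 2 / 2)) then 1 else 0) := by
  rcases le_or_gt 8 |v| with h8 | h8
  · have hsq : 8 * |v| ≤ v ^ 2 := by nlinarith [abs_nonneg v, sq_abs v, abs_mul_abs_self v]
    have hconst : (0 : ℤ) ≤ 16 - (if Odd v then 1 else 0) - 4 * (if ¬ Odd v ∧ Odd (v / 2) then 1 else 0)
        - 16 * (if ¬ Odd v ∧ ¬ Odd (v / 2) ∧ ¬ Odd (v / 2 / 2) then 1 else 0)
        - 8 * (if Odd v ∧ (Odd (v / 2) ↔ Odd (v / 2 / 2)) then 1 else 0) := by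
      split_ifs <;> (try simp only [Int.odd_iff] at *) <;> omega
    linarith
  · have h1 : -7 ≤ v := by have := (abs_lt.1 h8).1; omega
    have h2 : v ≤ 7 := by have := (abs_lt.1 h8).2; omega
    interval_cases v <;> norm_num [Int.odd_iff]

/-! ### The capacity theorem -/

section Capacity

variable (g : (Fin (8 + 8) → Bool) → Bool) (u : (Fin (8 + 8) → Bool) → ℤ)

/-- Summing `sx_pt` against Parseval: `8·Σ|u| ≤ 2²¹ − #odd − 4#A − 16#B − 8#C` for the four digit sets. [this work] -/
theorem sx_sum_pt (hu : ∀ x, W (fun y => signOf (g y)) x = (2 : ℝ) ^ 6 * (u x : ℝ)) :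
    8 * ∑ x, |u x| ≤ 2 ^ 21 - (#(univ.filter fun x : Fin (8 + 8) → Bool => Odd (u x)) : ℤ)
      - 4 * (#(univ.filter fun x : Fin (8 + 8) → Bool => ¬ Odd (u x) ∧ Odd (u x / 2)) : ℤ)
      - 16 * (#(univ.filter fun x : Fin (8 + 8) → Bool => ¬ Odd (u x) ∧ ¬ Odd (u x / 2) ∧ ¬ Odd (u x / 2 / 2)) : ℤ)
      - 8 * (#(univ.filter fun x : Fin (8 + 8) → Bool => Odd (u x) ∧ (Odd (u x / 2) ↔ Odd (u x / 2 / 2))) : ℤ) := by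
  have hpar := sx_sum_u_sq g u hu
  have h := sum_le_sum fun x (_ : x ∈ (univ : Finset (Fin (8 + 8) → Bool))) => sx_pt (u x)
  rw [← mul_sum] at h
  simp only [sum_sub_distrib, sum_add_distrib, ← mul_sum, sum_boole, sum_const, card_univ, Fintype.card_fun,
    Fintype.card_bool, Fintype.card_fin] at h
  rw [hpar] at h
  norm_num at h ⊢
  linarith

/-- **Capacity `31/32` on 16 bits.** For cubic `g : 𝔽₂¹⁶ → 𝔽₂` with `W_g = 64u` and some `u(x)` odd (non-zero level-6
parity), `Σ_x |W_g(x)| ≤ (31/32)·2²⁴`.  (Type O: pointwise.  Split: the balanced affine parity gives `2¹⁵`, and the digit sets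
`A, B, C` of degrees `≤ 3, 5, 4` give the other `2¹⁵` by the Reed–Muller bound unless all three are empty — the residual
configuration, which is empty by `sx_residual_false`.) [this work] -/
theorem sx_capacity_31_32 (hg : IsDegLeFun 3 g) (hu : ∀ x, W (fun y => signOf (g y)) x = (2 : ℝ) ^ 6 * (u x : ℝ))
    (hodd : ∃ x, Odd (u x)) :
    ∑ x, |W (fun y => signOf (g y)) x| ≤ (2 : ℝ) ^ (3 * 8) * (31 / 32) := by
  have hsum := sx_sum_pt g u hu
  set O := univ.filter fun x : Fin (8 + 8) → Bool => Odd (u x) with hO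
  set A := univ.filter fun x : Fin (8 + 8) → Bool => ¬ Odd (u x) ∧ Odd (u x / 2) with hA
  set B := univ.filter fun x : Fin (8 + 8) → Bool => ¬ Odd (u x) ∧ ¬ Odd (u x / 2) ∧ ¬ Odd (u x / 2 / 2) with hB
  set C := univ.filter fun x : Fin (8 + 8) → Bool => Odd (u x) ∧ (Odd (u x / 2) ↔ Odd (u x / 2 / 2)) with hC
  -- the digit degrees
  have hd0 : IsDegLeFun 1 (fun x => decide (Odd (u x))) := sx_digitZero g u hg hu
  have hd1 : IsDegLeFun 2 (fun x => decide (Odd (u x / 2))) := sx_digitOne g u hg hu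
  have hd2 : IsDegLeFun 4 (fun x => decide (Odd (u x / 2 / 2))) := sx_digitTwo g u hg hu
  -- main count: `#O + 4#A + 16#B + 8#C ≥ 2^16`
  have hcount : (2 : ℤ) ^ 16 ≤ (#O : ℤ) + 4 * #A + 16 * #B + 8 * #C := by
    have hA0 : (0 : ℤ) ≤ #A := by positivity
    have hB0 : (0 : ℤ) ≤ #B := by positivity
    have hC0 : (0 : ℤ) ≤ #C := by positivity
    by_cases heven : ∃ x, ¬ Odd (u x)
    · -- split: `#O = 2^15`
      have hO15 : #O = 2 ^ 15 := sx_card_odd_of_split g u hg hu hodd heven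
      have hgain : (2 : ℤ) ^ 15 ≤ 4 * #A + 16 * #B + 8 * #C := by
        by_cases hxA : ∃ x, ¬ Odd (u x) ∧ Odd (u x / 2)
        · -- `A` is the support of the degree-3 function `¬d₀ ∧ d₁`
          have hdeg : IsDegLeFun 3 (fun x => (decide (Odd (u x)) ^^ true) && decide (Odd (u x / 2))) :=
            bb_deg_and (tb_isDegLeFun_xor_const hd0 true) hd1 (by norm_num)
          have hset : (univ.filter fun x : Fin (8 + 8) → Bool =>
              ((decide (Odd (u x)) ^^ true) && decide (Odd (u x / 2))) = true) = A := by
            rw [hA]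
            apply filter_congr
            intro x _
            simp
          obtain ⟨x₀, hx₀, hx₀'⟩ := hxA
          have hrm := bb_rmWeight_holds (8 + 8) 3 _ hdeg ⟨x₀, by simp [hx₀, hx₀']⟩
          rw [hset] at hrm
          have : (2 : ℤ) ^ (8 + 8) ≤ 2 ^ 3 * (#A : ℤ) := by exact_mod_cast hrm
          norm_num at this
          linarith
        · push Not at hxA
          by_cases hxB : ∃ x, ¬ Odd (u x) ∧ ¬ Odd (u x / 2 / 2)
          · -- `B` is the support of the degree-5 function `¬d₀ ∧ ¬d₂`
            have hdeg : IsDegLeFun 5 (fun x => (decide (Odd (u x)) ^^ true) && (decide (Odd (u x / 2 / 2)) ^^ true)) :=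
              bb_deg_and (tb_isDegLeFun_xor_const hd0 true) (tb_isDegLeFun_xor_const hd2 true) (by norm_num)
            have hset : (univ.filter fun x : Fin (8 + 8) → Bool =>
                ((decide (Odd (u x)) ^^ true) && (decide (Odd (u x / 2 / 2)) ^^ true)) = true) = B := by
              rw [hB]
              apply filter_congr
              intro x _
              simp only [Bool.xor_true, Bool.and_eq_true, Bool.not_eq_true', decide_eq_false_iff_not]
              exact ⟨fun h => ⟨h.1, hxA x h.1, h.2⟩, fun h => ⟨h.1, h.2.2⟩⟩
            obtain ⟨x₀, hx₀, hx₀'⟩ := hxB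
            have hrm := bb_rmWeight_holds (8 + 8) 5 _ hdeg ⟨x₀, by simp [hx₀, hx₀']⟩
            rw [hset] at hrm
            have : (2 : ℤ) ^ (8 + 8) ≤ 2 ^ 5 * (#B : ℤ) := by exact_mod_cast hrm
            norm_num at this
            linarith
          · push Not at hxB
            have hH : ∀ x, ¬ Odd (u x) → ¬ Odd (u x / 2) ∧ Odd (u x / 2 / 2) := fun x h => ⟨hxA x h, hxB x h⟩
            by_cases hxC : ∃ x, Odd (u x) ∧ (Odd (u x / 2) ↔ Odd (u x / 2 / 2))
            · -- `C` is the support of the degree-4 function `¬(d₁ ⊕ d₂)`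
              have hdeg : IsDegLeFun 4 (fun x => (decide (Odd (u x / 2)) ^^ decide (Odd (u x / 2 / 2))) ^^ true) :=
                tb_isDegLeFun_xor_const (bb_isDegLeFun_bxor (hd1.mono (by norm_num)) hd2) true
              have hset : (univ.filter fun x : Fin (8 + 8) → Bool =>
                  ((decide (Odd (u x / 2)) ^^ decide (Odd (u x / 2 / 2))) ^^ true) = true) = C := by
                rw [hC]
                apply filter_congr
                intro x _
                by_cases h0 : Odd (u x)
                · by_cases h1 : Odd (u x / 2) <;> by_cases h2 : Odd (u x / 2 / 2) <;> simp [h0, h1, h2]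
                · have h12 := hH x h0
                  simp [h0, h12.1, h12.2]
              obtain ⟨x₀, hx₀, hx₀'⟩ := hxC
              have hmem : ((decide (Odd (u x₀ / 2)) ^^ decide (Odd (u x₀ / 2 / 2))) ^^ true) = true := by
                by_cases h1 : Odd (u x₀ / 2)
                · have h2 : Odd (u x₀ / 2 / 2) := hx₀'.1 h1
                  simp [h1, h2]
                · have h2 : ¬ Odd (u x₀ / 2 / 2) := fun h => h1 (hx₀'.2 h)
                  simp [h1, h2]
              have hrm := bb_rmWeight_holds (8 + 8) 4 _ hdeg ⟨x₀, hmem⟩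
              rw [hset] at hrm
              have : (2 : ℤ) ^ (8 + 8) ≤ 2 ^ 4 * (#C : ℤ) := by exact_mod_cast hrm
              norm_num at this
              linarith
            · push Not at hxC
              exact absurd (sx_residual_false g u hg hu hodd heven hH fun x hx => by have := hxC x hx; tauto) id
      rw [hO15]
      push_cast
      linarith
    · -- type O: `#O = 2^16`
      push Not at heven
      have hO16 : #O = 2 ^ 16 := by
        rw [hO, filter_true_of_mem fun x _ => heven x, card_univ, Fintype.card_fun, Fintype.card_bool, Fintype.card_fin]
      rw [hO16]
      push_cast
      linarith
  -- from `8·Σ|u| ≤ 2^21 − 2^16` to the capacity bound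
  have hS : 8 * ∑ x, |u x| ≤ 2 ^ 21 - 2 ^ 16 := by linarith
  have hSR : (8 : ℝ) * ∑ x, |(u x : ℝ)| ≤ 2031616 := by
    have h : (((8 * ∑ x, |u x| : ℤ)) : ℝ) ≤ ((2 ^ 21 - 2 ^ 16 : ℤ) : ℝ) := by exact_mod_cast hS
    push_cast at h
    linarith
  have hW : ∑ x, |W (fun y => signOf (g y)) x| = (2 : ℝ) ^ 6 * ∑ x, |(u x : ℝ)| := by
    rw [mul_sum]
    exact sum_congr rfl fun x _ => by rw [hu x, abs_mul, abs_of_pos (by positivity)]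
  rw [hW]
  norm_num
  linarith

end Capacity

end Summit.QuantumAdvantage.QuantumAdvantage.Theorems.CubicForrelation.NearExactIsExact

end
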